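import Mathlib
import Summits.ValiantsHypothesis.ValiantsHypothesis.Theorems.LacunarySymmetroidMatrixDescartesCensusDefs
import Summits.ValiantsHypothesis.ValiantsHypothesis.Theorems.LacunarySymmetroidMatrixDescartesStubDescartesCeiling
import Summits.ValiantsHypothesis.ValiantsHypothesis.Theorems.MatrixDescartes.Negative.MatrixDescartesFalseOfTropicalMonster
import Summits.ValiantsHypothesis.ValiantsHypothesis.Theorems.KPlusLogSqLawWeakLiftingTowerGraftLawBoundedLetters
import Summits.ValiantsHypothesis.ValiantsHypothesis.Theorems.KPlusLogSqLawWeakLiftingTowerGraftLawVariantsBoundedLetters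

/-!
# Tower graft line — THE GRAFT LAWS S5 / S4 / S4b / S5ᴸ AT SIZE `m = 1`, FOR ALL `K` (the first fixed-size truncation; not Descartes-vacuous)

Calibration file for the line `Cruxes/WeakLifting/Lines/tower_graft.lean` (crux `WeakLifting` = stmt-ValiantsHypothesis-19561), objects of the
registered stubs S5 `stub_oneLetterGraftLaw : TowerGraftLaw`, S4 `stub_graftLawId : TowerGraftLawId`, S4b `stub_graftLawCorner : TowerGraftLawCorner`,
S5ᴸ `stub_graftLawPolylog : TowerGraftLawPolylog`.  NO stub is claimed and none of them is proved.  The companions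
`…TowerGraftLawBoundedLetters.lean` / `…TowerGraftLawVariantsBoundedLetters.lean` / `…TowerGraftSizeDoublingBoundedLetters.lean` truncate the
LETTER count (`K ≤ K₀`, Descartes zone); this file truncates the SIZE instead — `m ≤ 1`, ALL `K` — which is NOT Descartes-vacuous: at size `1`
the grafted `(K+1)`-letter pencil may have `K` positive roots while the additive term is `2^{C·log₂² 1} = 1`, so the factor term `2^C·B` must pay,
and it does because the class budget of a `1`-tower with `K` letters is at least `K − 1`:

* ★ `pred_le_of_posRootLawOn_one` — **support-level Descartes sharpness at size one**: for EVERY strictly increasing support `d : Fin K → ℕ`,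
  `PosRootLawOn 1 K B d → K − 1 ≤ B`.  Proof by the tree's Viro patchworking (`MatrixDescartes.Negative.le_card_posRoots_patch`): the one-row
  tropical design with valuations `d l²` and signs `(−1)^l` has the sign-alternating dominant chain `θ_k = 2·d k` (class `k` beats class `l` by
  `(d k − d l)²`), hence a real `1 × 1` pencil on `d` with `K − 1` distinct positive zeros.  (The tree's format-level `Census.row_one` uses the
  support `(0, 1, …, K−1)`; the line's `one_le_of_posRootLawOn_one` gives only `1 ≤ B`.)
* ★ `towerGraftLaw_size_one` — the body of S5 `TowerGraftLaw` at `m = 1` for ALL `K`, with `C = 1`: `PosRootLawOn 1 K B d →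
  PosRootLawOn 1 (K+1) (2^1·B + 2^{1·log₂² 1}) (Fin.snoc d D)` on `1`-towers (Descartes `≤ K` for the graft, `K ≤ 2(K−1) + 1`).
* `towerGraftLawId_size_one`, `towerGraftLawCorner_size_one`, `towerGraftLawPolylog_size_one` — the same for the bodies of S4 (identity graft),
  S4b (corner graft) and S5ᴸ (`(E, A) = (1, 0)`: `(log₂ 1 + 2)·B + 2^{(log₂ 1 + 2)^0} = 2B + 2`).

READING (located, not claimed).  Together with the letter truncations: every registered stub of the line holds on `{K ≤ K₀} ∪ {m ≤ 1}` for every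
`K₀`.  The FIRST OPEN FIXED-SIZE TRUNCATION is `m = 2`, all `K`: «`∃ C, ∀ K B D` and every `2`-tower `d`, `PosRootLawOn 2 K B d →
PosRootLawOn 2 (K+1) (2^C·B + 2^C) (Fin.snoc d D)`» — it would follow from an order-of-magnitude Descartes floor `ζ₊(2; d) ≥ K²/2^{C'}` on EVERY
`2`-tower (the grafted count is `≤ C(K+2, 2) − 1` by Descartes), which the tree does not have: symmetric patchworking floors at `m = 2` are linear in
`K` (`SymmetricTwoK.le_of_tropRootLawAt_two`: `3K − 4`), the real census knows `ζ(2,K) = C(K+1,2) − 1` only for `K ≤ 5` (`DescartesExtremalThin`, open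
from `K = 6`).  HONEST FRAMING: nothing on S4/S4b/S4d/S4f/S5/S5ᴸ in their quantifier order, TowerB, `WeakLifting`, Conjecture B, `MatrixDescartes`
(18050) or `VP ≠ VNP`.  Def-free.  Seat: prover leafhand-val-kpluslogsqlaw-1 g2, `--supports stmt-ValiantsHypothesis-19561`.
-/

-- `Summit.ValiantsHypothesis.ValiantsHypothesis.…` repeats a component by the D-0017 layout
-- (single-conjunct summit), which the `dupNamespace` linter flags; the name is mandated.
set_option linter.dupNamespace false

namespace Summit.ValiantsHypothesis.ValiantsHypothesis.Theorems.KPlusLogSqLaw.TowerGraft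

open Polynomial Matrix
open scoped BigOperators Polynomial
open Summit.ValiantsHypothesis.ValiantsHypothesis.Theorems.LacunarySymmetroidMatrixDescartes (PosRootLawOn stub_descartesCeiling)
open Summit.ValiantsHypothesis.ValiantsHypothesis.Theorems.MatrixDescartes.Negative (tropWeight termSign IsDominant le_card_posRoots_patch)

section SizeOne

/-! ## §1 The one-row tropical design and support-level Descartes sharpness at size one -/

/-- a Leibniz term of a one-row design has sign `ε 0 0 (class of the row)`. [bookkeeping] -/
theorem termSign_oneRow {K : ℕ} (ε : Fin 1 → Fin 1 → Fin K → ℤ) (σ : Equiv.Perm (Fin 1)) (c : Fin 1 → Fin K) :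
    termSign ε (σ, c) = ε 0 0 (c 0) := by
  have hσ : σ = 1 := Subsingleton.elim _ _
  subst hσ
  simp [termSign]

/-- a Leibniz term of a one-row design has tropical weight `θ·d(class) − v 0 0 (class)`. [bookkeeping] -/
theorem tropWeight_oneRow {K : ℕ} (d : Fin K → ℕ) (v : Fin 1 → Fin 1 → Fin K → ℤ) (θ : ℤ) (σ : Equiv.Perm (Fin 1))
    (c : Fin 1 → Fin K) : tropWeight d v θ (σ, c) = θ * (d (c 0) : ℤ) - v 0 0 (c 0) := by
  have hσ : σ = 1 := Subsingleton.elim _ _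
  subst hσ
  simp [tropWeight]

/-- **SUPPORT-LEVEL DESCARTES SHARPNESS AT SIZE ONE.**  On every strictly increasing support `d : Fin K → ℕ` some real `1 × 1` pencil — i.e. some
`K`-nomial with support `d` — has `K − 1` distinct positive zeros; in class-budget currency: `PosRootLawOn 1 K B d → K − 1 ≤ B`.  Proof: Viro
patchworking (`le_card_posRoots_patch`) of the one-row design `v l = d l²`, `ε l = (−1)^l`, whose chain `θ_k = 2·d k` is dominant (class `k` beats
class `l ≠ k` by `(d k − d l)²`) and sign-alternating. [folklore: Descartes' bound is attained on every support; this kernel route is the cell's] -/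
theorem pred_le_of_posRootLawOn_one {K B : ℕ} (d : Fin K → ℕ) (hd : StrictMono d) (hB : PosRootLawOn 1 K B d) : K - 1 ≤ B := by
  rcases K with _ | n
  · simp
  · -- the one-row design and its chain of `n + 1` terms
    set v : Fin 1 → Fin 1 → Fin (n + 1) → ℤ := fun _ _ l => (d l : ℤ) ^ 2 with hv
    set ε : Fin 1 → Fin 1 → Fin (n + 1) → ℤ := fun _ _ l => (-1) ^ (l : ℕ) with hε
    set θ : Fin (n + 1) → ℤ := fun k => 2 * (d k : ℤ) with hθ
    set p : Fin (n + 1) → Equiv.Perm (Fin 1) × (Fin 1 → Fin (n + 1)) := fun k => (1, fun _ => k) with hp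
    have hεabs : ∀ i j l, (ε i j l).natAbs ≤ 1 := by
      intro i j l
      rcases neg_one_pow_eq_or ℤ (l : ℕ) with h | h <;> simp [hε, h]
    have hθmono : StrictMono θ := by
      intro a b hab
      have := hd hab
      simp only [hθ]
      omega
    have hsign : ∀ k : Fin (n + 1), termSign ε (p k) = (-1) ^ (k : ℕ) := by
      intro k
      simp only [hp, termSign_oneRow, hε]
    have hdom : ∀ k, IsDominant d v ε (θ k) (p k) := by
      intro k
      refine ⟨?_, ?_⟩
      · rw [hsign]
        exact pow_ne_zero _ (by norm_num)
      · rintro ⟨σ', c'⟩ hne _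
        have hσ' : σ' = 1 := Subsingleton.elim _ _
        subst hσ'
        have hl : c' 0 ≠ k := by
          intro h
          apply hne
          simp only [hp]
          refine Prod.ext rfl (funext fun i => ?_)
          have hi : i = 0 := Subsingleton.elim _ _
          subst hi
          exact h
        rw [tropWeight_oneRow]
        simp only [hp, tropWeight_oneRow, hv, hθ]
        have hne' : (d (c' 0) : ℤ) ≠ (d k : ℤ) := by
          intro h
          exact hl (hd.injective (by exact_mod_cast h))
        have hsq : 0 < ((d k : ℤ) - (d (c' 0) : ℤ)) ^ 2 := by
          have : (d k : ℤ) - (d (c' 0) : ℤ) ≠ 0 := sub_ne_zero.mpr (Ne.symm hne')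
          positivity
        nlinarith [hsq]
    have halt : ∀ k : Fin n, termSign ε (p k.castSucc) * termSign ε (p k.succ) < 0 := by
      intro k
      rw [hsign, hsign, Fin.val_castSucc, Fin.val_succ, ← pow_add, show (k : ℕ) + ((k : ℕ) + 1) = 2 * (k : ℕ) + 1 by ring,
        pow_add, pow_mul]
      norm_num
    obtain ⟨T, hT⟩ := le_card_posRoots_patch d v ε hεabs θ hθmono p hdom halt
    have hsymm : ∀ l, (T l).IsSymm := by
      intro l
      ext i j
      have hi : i = 0 := Subsingleton.elim _ _
      have hj : j = 0 := Subsingleton.elim _ _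
      subst hi; subst hj; rfl
    have hZ := hB T hsymm
    have : n ≤ B := hT.trans hZ
    simpa using this

/-! ## §2 The graft laws at size one, all `K` -/

/-- **S5 AT SIZE ONE, ALL `K` (`C = 1`).**  On a `1`-tower `d` with `K` letters and far exponent `D`: `PosRootLawOn 1 K B d →
PosRootLawOn 1 (K+1) (2^1·B + 2^{1·(log₂ 1)²}) (Fin.snoc d D)` — the grafted `(K+1)`-nomial has at most `K ≤ 2(K−1) + 1` positive zeros.
(The far-exponent hypothesis is idle; S5 itself — one `C` for all `m` AND `K` — is NOT proved here.) [this work] -/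
theorem towerGraftLaw_size_one :
    ∀ (K B D : ℕ) (d : Fin K → ℕ), (∀ l l' : Fin K, l < l' → 1 * d l < d l') → (∀ l, 1 * d l < D) →
      PosRootLawOn 1 K B d → PosRootLawOn 1 (K + 1) (2 ^ 1 * B + 2 ^ (1 * Nat.log 2 1 ^ 2)) (Fin.snoc d D) := by
  intro K B D d hd _ hB S hS
  have hdesc := posRootLawOn_snoc_descartes 1 K D d S hS
  rw [Nat.choose_one_right] at hdesc
  have hmono : StrictMono d := fun l l' h => by simpa using hd l l' h
  have hKB := pred_le_of_posRootLawOn_one d hmono hB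
  have h0 : Nat.log 2 1 = 0 := by simp
  rw [h0]
  simp only [pow_one, zero_pow two_ne_zero, mul_zero, pow_zero]
  omega

/-- **S4 (identity graft) AT SIZE ONE, ALL `K` (`C = 1`).** [this work] -/
theorem towerGraftLawId_size_one :
    ∀ (K B D : ℕ) (d : Fin K → ℕ), (∀ l l' : Fin K, l < l' → 1 * d l < d l') → (∀ l, 1 * d l < D) →
      PosRootLawOn 1 K B d → ∀ (S : Fin K → Matrix (Fin 1) (Fin 1) ℝ), (∀ l, (S l).IsSymm) →
        ((Matrix.det ((∑ l, ((X : ℝ[X]) ^ d l) • (S l).map Polynomial.C) +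
            (X : ℝ[X]) ^ D • (1 : Matrix (Fin 1) (Fin 1) ℝ[X]))).roots.toFinset.filter
          (fun t => 0 < t)).card ≤ 2 ^ 1 * B + 2 ^ (1 * Nat.log 2 1 ^ 2) := by
  intro K B D d hd hD hB S hS
  have h := towerGraftLaw_size_one K B D d hd hD hB (Fin.snoc S 1) (snoc_isSymm S 1 hS Matrix.isSymm_one)
  rw [pencil_snoc, Matrix.map_one (Polynomial.C : ℝ → ℝ[X]) (map_zero _) (map_one _)] at h
  exact h

/-- **S4b (corner graft) AT SIZE ONE, ALL `K` (`C = 1`).** [this work] -/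
theorem towerGraftLawCorner_size_one :
    ∀ (K B D : ℕ) (d : Fin K → ℕ), (∀ l l' : Fin K, l < l' → 1 * d l < d l') → (∀ l, 1 * d l < D) →
      PosRootLawOn 1 K B d → ∀ (S : Fin K → Matrix (Fin 1) (Fin 1) ℝ) (i : Fin 1), (∀ l, (S l).IsSymm) →
        ((Matrix.det ((∑ l, ((X : ℝ[X]) ^ d l) • (S l).map Polynomial.C) +
            (X : ℝ[X]) ^ D • (Matrix.vecMulVec (Pi.single i (1 : ℝ)) (Pi.single i (1 : ℝ))).map Polynomial.C)).roots.toFinset.filter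
          (fun t => 0 < t)).card ≤ 2 ^ 1 * B + 2 ^ (1 * Nat.log 2 1 ^ 2) := by
  intro K B D d hd hD hB S i hS
  have hT : (Matrix.vecMulVec (Pi.single i (1 : ℝ)) (Pi.single i (1 : ℝ))).IsSymm := by
    unfold Matrix.IsSymm
    exact Matrix.transpose_vecMulVec _ _
  have h := towerGraftLaw_size_one K B D d hd hD hB (Fin.snoc S (Matrix.vecMulVec (Pi.single i (1 : ℝ)) (Pi.single i (1 : ℝ))))
    (snoc_isSymm S _ hS hT)
  rw [pencil_snoc] at h
  exact h

/-- **S5ᴸ (polylog graft law) AT SIZE ONE, ALL `K` (`(E, A) = (1, 0)`: bound `2B + 2`).** [this work] -/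
theorem towerGraftLawPolylog_size_one :
    ∀ (K B D : ℕ) (d : Fin K → ℕ), (∀ l l' : Fin K, l < l' → 1 * d l < d l') → (∀ l, 1 * d l < D) →
      PosRootLawOn 1 K B d →
      PosRootLawOn 1 (K + 1) ((Nat.log 2 1 + 2) ^ 1 * B + 2 ^ ((Nat.log 2 1 + 2) ^ 0)) (Fin.snoc d D) := by
  intro K B D d hd _ hB S hS
  have hdesc := posRootLawOn_snoc_descartes 1 K D d S hS
  rw [Nat.choose_one_right] at hdesc
  have hmono : StrictMono d := fun l l' h => by simpa using hd l l' h
  have hKB := pred_le_of_posRootLawOn_one d hmono hB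
  have h0 : Nat.log 2 1 = 0 := by simp
  rw [h0]
  simp only [zero_add, pow_one, pow_zero]
  omega

end SizeOne

end Summit.ValiantsHypothesis.ValiantsHypothesis.Theorems.KPlusLogSqLaw.TowerGraft
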